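import Mathlib

/-!
# The BRANCH LEMMA's product inequality (p6, gen 26; C-041.md §11 (b))

Pure arithmetic, no graphs.  The one-anchor identities of C-041.md §11 (b) write, for a zone `Z` with the
single anchor `k` and branches `Y_i`, `|𝓛_Z| = ∏ᵢ (aᵢ + fᵢ) − ∏ᵢ fᵢ` and
`|𝓡_Z| = ∏ᵢ (Vᵢ + fᵢ + bᵢ) − ∏ᵢ (fᵢ + bᵢ)` when `k` carries no terminal edge, and `∏ᵢ (aᵢ + fᵢ)`,
`∏ᵢ (Vᵢ + fᵢ + bᵢ)` when `k` carries `1`-edges only.  The BRANCH LEMMA «`aᵢ ≤ Vᵢ` for every branch ⟹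
`|𝓛_Z| ≤ |𝓡_Z|`» is the termwise comparison of the expansions
`∏ (x + y) − ∏ y = Σ_{∅ ≠ S} ∏_S x · ∏_{∉ S} y` (`prod_add_sub_prod_eq_sum`), which holds for any
`x ≤ x'`, `y ≤ y'` (`prod_add_sub_prod_le`); `branch_lemma_edgeFree` / `branch_lemma_oneEdges` are the two
instances in the notation of §11 (b).  (LEMMA (INV-STAR)'s termwise bound, `C041InvStarCountIneq`, is the case
where the branches are single leaves.)
-/

namespace PercRepro

namespace BranchProduct

open Finset

variable {ι : Type*} [DecidableEq ι]

/-- The expansion `∏_{i ∈ s} (x i + y i) − ∏_{i ∈ s} y i = Σ_{∅ ≠ t ⊆ s} ∏_{i ∈ t} x i · ∏_{i ∈ s ∖ t} y i`. -/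
theorem prod_add_sub_prod_eq_sum (s : Finset ι) (x y : ι → ℕ) :
    ∏ i ∈ s, (x i + y i) - ∏ i ∈ s, y i
      = ∑ t ∈ s.powerset.erase ∅, (∏ i ∈ t, x i) * ∏ i ∈ s \ t, y i := by
  rw [Finset.prod_add, ← Finset.add_sum_erase _ _ (Finset.empty_mem_powerset s)]
  simp only [Finset.prod_empty, one_mul, Finset.sdiff_empty]
  exact Nat.add_sub_cancel_left _ _

/-- **THE BRANCH LEMMA, abstract** (C-041.md §11 (b)): `x ≤ x'` and `y ≤ y'` on `s` give
`∏ (x + y) − ∏ y ≤ ∏ (x' + y') − ∏ y'` — termwise on the expansions. -/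
theorem prod_add_sub_prod_le (s : Finset ι) (x y x' y' : ι → ℕ)
    (hx : ∀ i ∈ s, x i ≤ x' i) (hy : ∀ i ∈ s, y i ≤ y' i) :
    ∏ i ∈ s, (x i + y i) - ∏ i ∈ s, y i ≤ ∏ i ∈ s, (x' i + y' i) - ∏ i ∈ s, y' i := by
  rw [prod_add_sub_prod_eq_sum, prod_add_sub_prod_eq_sum]
  apply Finset.sum_le_sum
  intro t ht
  have hts : t ⊆ s := Finset.mem_powerset.mp (Finset.mem_of_mem_erase ht)
  apply Nat.mul_le_mul
  · exact Finset.prod_le_prod (fun i _ => Nat.zero_le _) fun i hi => hx i (hts hi)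
  · exact Finset.prod_le_prod (fun i _ => Nat.zero_le _) fun i hi => hy i (Finset.sdiff_subset hi)

/-- The BRANCH LEMMA in the notation of §11 (b), `k` without terminal edges: `aᵢ ≤ Vᵢ` for every branch
gives `∏ (aᵢ + fᵢ) − ∏ fᵢ ≤ ∏ (Vᵢ + fᵢ + bᵢ) − ∏ (fᵢ + bᵢ)`. -/
theorem branch_lemma_edgeFree (s : Finset ι) (a f b V : ι → ℕ) (h : ∀ i ∈ s, a i ≤ V i) :
    ∏ i ∈ s, (a i + f i) - ∏ i ∈ s, f i
      ≤ ∏ i ∈ s, (V i + f i + b i) - ∏ i ∈ s, (f i + b i) := by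
  have := prod_add_sub_prod_le s a f V (fun i => f i + b i) h fun i _ => Nat.le_add_right _ _
  simpa only [← add_assoc] using this

omit [DecidableEq ι] in
/-- The BRANCH LEMMA in the notation of §11 (b), `k` with `1`-edges only: `aᵢ ≤ Vᵢ` for every branch
gives `∏ (aᵢ + fᵢ) ≤ ∏ (Vᵢ + fᵢ + bᵢ)`. -/
theorem branch_lemma_oneEdges (s : Finset ι) (a f b V : ι → ℕ) (h : ∀ i ∈ s, a i ≤ V i) :
    ∏ i ∈ s, (a i + f i) ≤ ∏ i ∈ s, (V i + f i + b i) :=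
  Finset.prod_le_prod (fun i _ => Nat.zero_le _) fun i hi => by have := h i hi; omega

end BranchProduct

end PercRepro
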